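import Literature.Probability.LatticeModels.SahiThirdOrderCorrelation
import Literature.Probability.LatticeModels.ProdBernoulliIndependence
import Literature.Probability.Percolation.PercolationEvents
import Mathlib.Tactic.Linarith
import Mathlib.Tactic.Ring
import HarnessLib

/-!
# The increasing star from ONE independent-copy comparison `(P_k)`, and the covariance / W-domination forms of `(P_k)`
# (Sahi programme, prover prim-sahi-p2 gen 34)

Support file (`--supports stmt-CriticalPhenomena-4575`).  No definitions, no named facts, no sorries; standard axioms.
Memo `run/shared/lean/prim/prim-sahi/FROM-prim-sahi-p2-gen34-WDOM.md` §1–§2, `prim-sahi-p2/PROOF-E3.md` §44.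

Notation (root `s`, targets `b, c, y`; `q_S = P(S ⊆ C_s)`): the increasing star is `E₃ = 2q_{bcy} − q_b q_{cy} − q_c q_{by} − q_y q_{bc} + q_b q_c q_y`
(`sahiE3 (prodBernoulli w) (openConn s b) (openConn s c) (openConn s y)`), and for the target `y` the **independent-copy comparison** is
`(P_y)  G_y := 2q_{bcy} + 2q_bq_cq_y − q_b q_{cy} − q_c q_{by} − 2 q_y q_{bc} ≥ 0`, i.e. `E₃(B_b,B_c,B_y) ≥ E₃(B_b,B_c,B_y^⊥) = q_y·Cov(B_b,B_c)` with `B_y^⊥`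
an independent event of the same probability (census W137 of prim-sahi-census gen 42: `S(A) ≥ 0`; p2 gen 4 (15c), gen 33 §9).  This file records, as
pure algebra plus Harris' inequality:

* `sahiE3_eq_half_pk_add` — the identity `E₃ = ½·G_y + ½(q_{bcy} − q_b q_{cy}) + ½(q_{bcy} − q_c q_{by})` (any measure, any three events);
* `sahiE3_ge_half_pk` — hence `E₃ ≥ ½·G_y` for increasing events under a product measure (the two brackets are Harris covariances), and
  **`incStar_nonneg_of_pk`**: `(P_y)` for the single target `y` already gives the increasing star `E₃({s↔b},{s↔c},{s↔y}) ≥ 0`;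
* `pk_eq_two_cov_sub` — `G_y = 2·Cov(B_y, B_b∩B_c) − q_b·Cov(B_y,B_c) − q_c·Cov(B_y,B_b)` = `Cov(1_{B_y}, W_{bc})` with
  `W_{bc} = 2·1_{B_b∩B_c} − q_b 1_{B_c} − q_c 1_{B_b}` (the "W-domination" functional of the memo, evaluated at `f = 1_{B_y}`);
* `pk_eq_condDrop` — `G_y = 2[q_{bc} P(R) − P(B_b∩B_c∩R)] − q_b[q_c P(R) − P(B_c∩R)] − q_c[q_b P(R) − P(B_b∩R)]` with `R = (B_y)ᶜ = {s ↛ y}`: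
  `(P_y)` says that conditioning on the avoidance event `{s ↛ y}` lowers the double connection `{s↔b, s↔c}` at least half as much as the
  `q`-weighted single connections.

Nothing here asserts `(P_y)`; it is census-clean (0 violations in every census of the cell) and open.
-/

noncomputable section

namespace Summit.CriticalPhenomena.PercolationContinuityZ3.Theorems

namespace IncStar

open MeasureTheory Set Literature.Probability.Percolation Literature.Probability.LatticeModels
open scoped Classical

/-! ### Pure algebra -/

/-- The identity `E₃ = ½·G_y + ½(q_W − q_b q_{cy}) + ½(q_W − q_c q_{by})` behind `incStar_nonneg_of_pk`, over the reals. [this work] -/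
theorem sahiE3_expr_eq_half_pk_add (qb qc qy qbc qby qcy qW : ℝ) :
    2 * qW + qb * qc * qy - (qb * qcy + qc * qby + qy * qbc)
      = (2 * qW + 2 * (qb * qc * qy) - qb * qcy - qc * qby - 2 * (qy * qbc)) / 2
        + (qW - qb * qcy) / 2 + (qW - qc * qby) / 2 := by
  ring

variable {Ω : Type*} [MeasurableSpace Ω]

/-- **`E₃ = ½·G_y + ½·(two Harris-type brackets)`** for any measure and any three events `B, C, Y`:
`sahiE3 μ B C Y = ½[2μ(BCY) + 2μBμCμY − μB·μ(CY) − μC·μ(BY) − 2μY·μ(BC)] + ½[μ(BCY) − μB·μ(CY)] + ½[μ(BCY) − μC·μ(BY)]`. [this work] -/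
theorem sahiE3_eq_half_pk_add (μ : Measure Ω) (B C Y : Set Ω) :
    sahiE3 μ B C Y
      = (2 * μ.real (B ∩ C ∩ Y) + 2 * (μ.real B * μ.real C * μ.real Y) - μ.real B * μ.real (C ∩ Y)
            - μ.real C * μ.real (B ∩ Y) - 2 * (μ.real Y * μ.real (B ∩ C))) / 2
        + (μ.real (B ∩ C ∩ Y) - μ.real B * μ.real (C ∩ Y)) / 2
        + (μ.real (B ∩ C ∩ Y) - μ.real C * μ.real (B ∩ Y)) / 2 := by
  rw [sahiE3_def, Set.inter_comm B Y, Set.inter_comm C Y]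
  rw [Set.inter_comm Y B, Set.inter_comm Y C]
  ring

/-- **The independent-copy margin in covariance form**: `G_y = 2·Cov(Y, B∩C) − μB·Cov(Y,C) − μC·Cov(Y,B)`, i.e. `G_y` is the covariance of `1_Y`
with the (non-monotone) statistic `W_{BC} = 2·1_{B∩C} − μ(B)·1_C − μ(C)·1_B`. [this work] -/
theorem pk_eq_two_cov_sub (μ : Measure Ω) (B C Y : Set Ω) :
    2 * μ.real (B ∩ C ∩ Y) + 2 * (μ.real B * μ.real C * μ.real Y) - μ.real B * μ.real (C ∩ Y)
        - μ.real C * μ.real (B ∩ Y) - 2 * (μ.real Y * μ.real (B ∩ C))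
      = 2 * (μ.real (B ∩ C ∩ Y) - μ.real (B ∩ C) * μ.real Y)
        - μ.real B * (μ.real (C ∩ Y) - μ.real C * μ.real Y)
        - μ.real C * (μ.real (B ∩ Y) - μ.real B * μ.real Y) := by
  ring

/-- **The independent-copy margin as a comparison of conditional drops**: with `r = μ(R)`, `R` the complement-type event entering only through
the numbers `μ(B∩R) = μB − μ(B∩Y)`, `μ(C∩R) = μC − μ(C∩Y)`, `μ(B∩C∩R) = μ(B∩C) − μ(B∩C∩Y)`, `r = 1 − μY` (these four substitutions are the
hypotheses, so that the lemma is measure-free):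
`G_y = 2[μ(BC)·r − μ(BCR)] − μB[μC·r − μ(CR)] − μC[μB·r − μ(BR)]`. [this work] -/
theorem pk_eq_condDrop (mB mC mY mBC mBY mCY mBCY r mBR mCR mBCR : ℝ)
    (hr : r = 1 - mY) (hBR : mBR = mB - mBY) (hCR : mCR = mC - mCY) (hBCR : mBCR = mBC - mBCY) :
    2 * mBCY + 2 * (mB * mC * mY) - mB * mCY - mC * mBY - 2 * (mY * mBC)
      = 2 * (mBC * r - mBCR) - mB * (mC * r - mCR) - mC * (mB * r - mBR) := by
  subst hr hBR hCR hBCR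
  ring

/-- **Criterion (any measure).**  If `μ(B∩C∩Y) ≥ μB·μ(C∩Y)`, `μ(B∩C∩Y) ≥ μC·μ(B∩Y)` (two Harris instances) and `G_y ≥ 0`, then
`½·G_y ≤ sahiE3 μ B C Y`; in particular `0 ≤ sahiE3 μ B C Y`. [this work] -/
theorem half_pk_le_sahiE3_of_harris (μ : Measure Ω) (B C Y : Set Ω)
    (h₁ : μ.real B * μ.real (C ∩ Y) ≤ μ.real (B ∩ C ∩ Y)) (h₂ : μ.real C * μ.real (B ∩ Y) ≤ μ.real (B ∩ C ∩ Y)) :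
    (2 * μ.real (B ∩ C ∩ Y) + 2 * (μ.real B * μ.real C * μ.real Y) - μ.real B * μ.real (C ∩ Y)
        - μ.real C * μ.real (B ∩ Y) - 2 * (μ.real Y * μ.real (B ∩ C))) / 2 ≤ sahiE3 μ B C Y := by
  rw [sahiE3_eq_half_pk_add]
  have h1' : 0 ≤ (μ.real (B ∩ C ∩ Y) - μ.real B * μ.real (C ∩ Y)) / 2 := by linarith
  have h2' : 0 ≤ (μ.real (B ∩ C ∩ Y) - μ.real C * μ.real (B ∩ Y)) / 2 := by linarith
  linarith

/-! ### Product measures: the two brackets are Harris covariances -/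

section ProdBernoulli

variable {ι : Type*}

/-- **`E₃ ≥ ½·G_y` for increasing events under a product Bernoulli measure.**  For measurable up-sets `B, C, Y` of `Set ι`:
`½[2P(BCY) + 2P(B)P(C)P(Y) − P(B)P(CY) − P(C)P(BY) − 2P(Y)P(BC)] ≤ sahiE3 (prodBernoulli p) B C Y`
(Harris: `P(B ∩ (C∩Y)) ≥ P(B)P(C∩Y)`, `P(C ∩ (B∩Y)) ≥ P(C)P(B∩Y)`). [this work] -/
theorem sahiE3_ge_half_pk (p : ι → unitInterval) {B C Y : Set (Set ι)}
    (hB : IsUpperSet B) (hC : IsUpperSet C) (hY : IsUpperSet Y)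
    (hBm : MeasurableSet B) (hCm : MeasurableSet C) (hYm : MeasurableSet Y) :
    (2 * (prodBernoulli p).real (B ∩ C ∩ Y)
        + 2 * ((prodBernoulli p).real B * (prodBernoulli p).real C * (prodBernoulli p).real Y)
        - (prodBernoulli p).real B * (prodBernoulli p).real (C ∩ Y)
        - (prodBernoulli p).real C * (prodBernoulli p).real (B ∩ Y)
        - 2 * ((prodBernoulli p).real Y * (prodBernoulli p).real (B ∩ C))) / 2
      ≤ sahiE3 (prodBernoulli p) B C Y := by
  have h₁ : (prodBernoulli p).real B * (prodBernoulli p).real (C ∩ Y) ≤ (prodBernoulli p).real (B ∩ C ∩ Y) := by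
    have := prodBernoulli_harris p hB (hC.inter hY) hBm (hCm.inter hYm)
    simpa [Set.inter_assoc] using this
  have h₂ : (prodBernoulli p).real C * (prodBernoulli p).real (B ∩ Y) ≤ (prodBernoulli p).real (B ∩ C ∩ Y) := by
    have := prodBernoulli_harris p hC (hB.inter hY) hCm (hBm.inter hYm)
    have e : C ∩ (B ∩ Y) = B ∩ C ∩ Y := by
      ext ω; simp only [Set.mem_inter_iff]; tauto
    rw [e] at this
    exact this
  exact half_pk_le_sahiE3_of_harris _ B C Y h₁ h₂

/-- **Sahi's `C₃` instance from `(P_y)`**: for measurable up-sets `B, C, Y` under a product Bernoulli measure, the independent-copy comparison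
`G_y ≥ 0` implies `0 ≤ sahiE3 (prodBernoulli p) B C Y`. [this work] -/
theorem sahiE3_nonneg_of_pk (p : ι → unitInterval) {B C Y : Set (Set ι)}
    (hB : IsUpperSet B) (hC : IsUpperSet C) (hY : IsUpperSet Y)
    (hBm : MeasurableSet B) (hCm : MeasurableSet C) (hYm : MeasurableSet Y)
    (hP : 0 ≤ 2 * (prodBernoulli p).real (B ∩ C ∩ Y)
        + 2 * ((prodBernoulli p).real B * (prodBernoulli p).real C * (prodBernoulli p).real Y)
        - (prodBernoulli p).real B * (prodBernoulli p).real (C ∩ Y)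
        - (prodBernoulli p).real C * (prodBernoulli p).real (B ∩ Y)
        - 2 * ((prodBernoulli p).real Y * (prodBernoulli p).real (B ∩ C))) :
    0 ≤ sahiE3 (prodBernoulli p) B C Y := by
  have := sahiE3_ge_half_pk p hB hC hY hBm hCm hYm
  linarith

end ProdBernoulli

/-! ### The increasing star of bond percolation -/

variable {n : ℕ}

/-- **The increasing star dominates half the independent-copy margin**: for every weight `w` and all `s b c y : Fin n`,
`½·G_y(s;b,c;y) ≤ E₃({s↔b},{s↔c},{s↔y})`. [this work] -/
theorem incStar_ge_half_pk (w : Sym2 (Fin n) → unitInterval) (s b c y : Fin n) :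
    (2 * (prodBernoulli w).real (openConn s b ∩ openConn s c ∩ openConn s y)
        + 2 * ((prodBernoulli w).real (openConn s b) * (prodBernoulli w).real (openConn s c)
                 * (prodBernoulli w).real (openConn s y))
        - (prodBernoulli w).real (openConn s b) * (prodBernoulli w).real (openConn s c ∩ openConn s y)
        - (prodBernoulli w).real (openConn s c) * (prodBernoulli w).real (openConn s b ∩ openConn s y)
        - 2 * ((prodBernoulli w).real (openConn s y) * (prodBernoulli w).real (openConn s b ∩ openConn s c))) / 2
      ≤ sahiE3 (prodBernoulli w) (openConn s b) (openConn s c) (openConn s y) :=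
  sahiE3_ge_half_pk w (isUpperSet_openConn s b) (isUpperSet_openConn s c) (isUpperSet_openConn s y)
    MeasurableSet.of_discrete MeasurableSet.of_discrete MeasurableSet.of_discrete

/-- **THE INCREASING STAR FROM `(P_y)` FOR ONE TARGET.**  If along the single target `y` the independent-copy comparison
`2q_{bcy} + 2q_bq_cq_y − q_bq_{cy} − q_cq_{by} − 2q_yq_{bc} ≥ 0` holds (`q_S = P_w(s ↔ S)`), then `0 ≤ E₃({s↔b},{s↔c},{s↔y})`. [this work] -/
theorem incStar_nonneg_of_pk (w : Sym2 (Fin n) → unitInterval) (s b c y : Fin n)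
    (hP : 0 ≤ 2 * (prodBernoulli w).real (openConn s b ∩ openConn s c ∩ openConn s y)
        + 2 * ((prodBernoulli w).real (openConn s b) * (prodBernoulli w).real (openConn s c)
                 * (prodBernoulli w).real (openConn s y))
        - (prodBernoulli w).real (openConn s b) * (prodBernoulli w).real (openConn s c ∩ openConn s y)
        - (prodBernoulli w).real (openConn s c) * (prodBernoulli w).real (openConn s b ∩ openConn s y)
        - 2 * ((prodBernoulli w).real (openConn s y) * (prodBernoulli w).real (openConn s b ∩ openConn s c))) :
    0 ≤ sahiE3 (prodBernoulli w) (openConn s b) (openConn s c) (openConn s y) := by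
  have := incStar_ge_half_pk w s b c y
  linarith

/-- **The increasing star from W-domination at one cluster event.**  If the statistic `W_{bc} = 2·1{s↔b, s↔c} − q_b·1{s↔c} − q_c·1{s↔b}` is positively
correlated with the connection `{s↔y}` — `2·Cov({s↔y},{s↔b,s↔c}) ≥ q_b·Cov({s↔y},{s↔c}) + q_c·Cov({s↔y},{s↔b})` (the instance `f = 1{s↔y}` of the
conjectured W-domination of the memo) — then `0 ≤ E₃({s↔b},{s↔c},{s↔y})`. [this work] -/
theorem incStar_nonneg_of_wdom_at_target (w : Sym2 (Fin n) → unitInterval) (s b c y : Fin n)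
    (hW : (prodBernoulli w).real (openConn s b) * ((prodBernoulli w).real (openConn s c ∩ openConn s y)
              - (prodBernoulli w).real (openConn s c) * (prodBernoulli w).real (openConn s y))
          + (prodBernoulli w).real (openConn s c) * ((prodBernoulli w).real (openConn s b ∩ openConn s y)
              - (prodBernoulli w).real (openConn s b) * (prodBernoulli w).real (openConn s y))
        ≤ 2 * ((prodBernoulli w).real (openConn s b ∩ openConn s c ∩ openConn s y)
              - (prodBernoulli w).real (openConn s b ∩ openConn s c) * (prodBernoulli w).real (openConn s y))) :
    0 ≤ sahiE3 (prodBernoulli w) (openConn s b) (openConn s c) (openConn s y) := by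
  refine incStar_nonneg_of_pk w s b c y ?_
  rw [pk_eq_two_cov_sub]
  linarith

end IncStar

end Summit.CriticalPhenomena.PercolationContinuityZ3.Theorems
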